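import Summits.QuantumFields.BalabanUV.Beta.KernelWardRelativeEnd
import Summits.QuantumFields.BalabanUV.Beta.VertexSandwichTransport
import Literature.MathematicalPhysics.QuantumFieldTheory.Balaban1983to89.Beta.SecondOrderResponse

/-!
# `BalabanUV.Beta.KernelWardRemainderParity` — binder row D1, the Ward binder hW: THE END's REMAINDER SOCKETS (`hNr`, `hN0`∕`hNt`)
# DISCHARGED FOR CHAIN-RULE VERTICES OF ROW-PARITY-ODD LOCAL TABLES (a second-order remainder table supplied by the W-side (L4) passes
# the `hW` end iff its rows are local and leg-parity-odd — the specification as a lemma)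
# (β sub-cell, lineage an1 = «direct one-loop in Bałaban's gauge», gen 27; sequel of `KernelWardRelativeEnd` §3)

NOT IN PRINT; OUR BOOKKEEPING.  HONEST FRAMING (cell contract, verbatim): «discharging `BetaPertH` makes Bałaban's UV stability
UNCONDITIONAL — a real constructive-QFT result; it is NOT the continuum limit and NOT the Clay problem.»  HONEST DEPENDENCY (verbatim):
«continuum YM on T⁴ ⇐ BetaPertH ∧ nine spine estimates (0/9 proved); BetaPertH ⇐ (D1) ∧ (D4) ∧ CAP+tail; G-an2-4 gates asym, D1 and
NE2/3/4.»  This module is [folklore] linear algebra over tree objects BY NAME; it types no statement of Bałaban's papers, carries no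
`[cite:]` tag and no `Prop` fact, instantiates NO binder of the β-function wall, and is NOT D1, NOT `BetaPertH`, NOT continuum, NOT Clay.

## What is proved, and where it sits

The `hW` ends (`KernelWardRelativeEnd.wardTransversal_flipK_TbalOf_JsBalBmNAtOf_ctrC(_parity)`, leaf-10's
`WardLocusRecursiveEnd.wardTransversal_flipK_TbalOf_JsRecBmAtOf(_parity)`) take the second-order pure-gauge law of the W-tables in the form
`divW (W j) y ν y′ = conjW 𝕄 0 V′ (X y) 0 X₂ + Nr j y ν y′` with a REMAINDER `Nr` subject to two sockets: `hNr : Loc (Nr j y ν y′)` and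
`hN0 : tadpole G_j (Nr j y ν y′) = 0` (or the structural `hNt : trK (Nr …) = −sgnK (Nr …)`).  The W-side reduction (leaf-10's
`WardLocusSecondOrderLaw.divW_vertex2OfK_of_tableLaw`, the (T2-S₂) table law) produces remainders of the shape
`vertexOfK G_j Lc (R j y) ν y′` — the chain-rule vertex of a REMAINDER TABLE `R j y` (the ad-rotated first-order table).  This file
says exactly what such a table must satisfy:

* §1 leg parity passes termwise through weighted superpositions and chain-rule vertices (scalar weights): `trK_wsum`, `sgnK_wsum`,
  `sgnK_vertexOfK`, `parityOdd_wsum`, `parityOdd_cwsum`; hence ROW-WISE PARITY-ODD tables (`trK (S κ u) = −sgnK (S κ u)`: ff- and mm-blocks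
  antisymmetric, fm-blocks symmetric under transposition) have parity-odd vertices (`trK_vertexOfK_eq_neg_sgnK_of_rows`, and the `vertexOfM`
  twin), and parity-oddness is closed under `+` (`parityOdd_add`) — so remainders may be accumulated piece by piece.
* §2 `tadpole_vertexOfK_eq_zero_of_rows` — for a spread sgn-SYMMETRIC propagator `K` (`trK K = sgnK K`) and a LOCAL row-parity-odd table,
  `tadpole K (vertexOfK K N S μ y) = 0` (`KernelWardRelativeEnd.tadpole_eq_zero_of_parity` + `VertexSandwichTransport.loc_vertexOfK`).
* §3 the wall instance, every step `j`, every in-block root: `G_j = coDressKBmAt (toSite r) Lc (KInvStep Lc j)` is spread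
  (`decays_coDressKBmAt_KInvStep`) and sgn-symmetric (`BubbleParity.trK_coDressKBmAt_KInvStep`), so for ANY family of remainder tables
  `R j y` with (R-loc) `∃ C δ, 0 < δ ∧ LocStencil (R j y) C δ` and (R-par) `trK (R j y κ u) = −sgnK (R j y κ u)` the three END sockets hold for
  `Nr j y ν y′ := vertexOfK G_j Lc (R j y) ν y′` in their LITERAL binder shapes: `remainder_loc`, `remainder_parity`, `remainder_tadpole_eq_zero`.

What this does NOT do: it supplies no remainder table (the (T2) table laws of the concrete plaquette ∕ averaging bi-tables are open,
statement-level) and discharges nothing of the W-side (L4).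
-/

noncomputable section

open Finset
open scoped BigOperators
open Literature.MathematicalPhysics.QuantumFieldTheory
open Literature.MathematicalPhysics.QuantumFieldTheory.Balaban1983to89
open Literature.MathematicalPhysics.QuantumFieldTheory.Balaban1983to89.Beta
open ExpKernelCalculus (MKer Decays tadpole)
open AffineAveraging (box toSite)
open OneStepResolventKernel (Fib wsum LocStencil)
open OneStepKernelFamily (KInvStep colH vertexOfK)
open InterLevelTransport (cwsum)
open SecondOrderResponse (colM vertexOfM)
open Summit.QuantumFields.BalabanUV.Beta.TameKernelCalculus
open Summit.QuantumFields.BalabanUV.Beta.BorderedHessian (sgnF sgnK sgnK_apply)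
open Summit.QuantumFields.BalabanUV.Beta.BubbleParity (sgnK_neg spr_of_decays trK_coDressKBmAt_KInvStep)
open Summit.QuantumFields.BalabanUV.Beta.ChartConjugationReflection (trK_vertexOfK vertexOfK_neg)
open Summit.QuantumFields.BalabanUV.Beta.VertexSandwichTransport (loc_vertexOfK)
open Summit.QuantumFields.BalabanUV.Beta.AxialDressingRooted (coDressKBmAt decays_coDressKBmAt_KInvStep)
open Summit.QuantumFields.BalabanUV.Beta.KernelWardRelativeEnd (tadpole_eq_zero_of_parity)

namespace Summit.QuantumFields.BalabanUV.Beta.KernelWardRemainderParity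

variable {d : ℕ} {N : ℕ}

/-! ## §1 Leg parity passes through weighted superpositions and chain-rule vertices -/

section Parity

/-- [folklore] Transposition passes termwise through a weighted superposition (scalar weights). -/
theorem trK_wsum (w : (Fin (d + 1) → ℤ) → ℝ) (T : (Fin (d + 1) → ℤ) → MKer (d + 1) (Fib d)) :
    trK (wsum w T) = wsum w (fun u => trK (T u)) := by
  funext x z a b
  simp only [trK_apply, OneStepResolventKernel.wsum]

/-- [folklore] Sign conjugation passes termwise through a weighted superposition (scalar weights). -/
theorem sgnK_wsum (w : (Fin (d + 1) → ℤ) → ℝ) (T : (Fin (d + 1) → ℤ) → MKer (d + 1) (Fib d)) :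
    sgnK (wsum w T) = wsum w (fun u => sgnK (T u)) := by
  funext x z a b
  simp only [sgnK_apply, OneStepResolventKernel.wsum, ← tsum_mul_left]
  exact tsum_congr fun u => by ring

/-- [folklore] Sign conjugation passes termwise through the chain-rule vertex (the `sgnK` twin of `ChartConjugationReflection.trK_vertexOfK`). -/
theorem sgnK_vertexOfK (K : MKer (d + 1) (Fib d)) (S : Fin (d + 1) → (Fin (d + 1) → ℤ) → MKer (d + 1) (Fib d)) (μ : Fin (d + 1))
    (y : Fin (d + 1) → ℤ) : sgnK (vertexOfK K N S μ y) = vertexOfK K N (fun κ u => sgnK (S κ u)) μ y := by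
  funext x z a b
  simp only [sgnK_apply, OneStepKernelFamily.vertexOfK, OneStepResolventKernel.wsum]
  rw [Finset.mul_sum]
  refine Finset.sum_congr rfl fun κ _ => ?_
  rw [← tsum_mul_left]
  exact tsum_congr fun u => by ring

/-- [folklore] Extension by zero preserves row parity: if every `Q w` is parity-odd, so is every `onLat N Q v`. -/
theorem parityOdd_onLat {Q : (Fin (d + 1) → ℤ) → MKer (d + 1) (Fib d)} (hpar : ∀ w, trK (Q w) = -sgnK (Q w))
    (v : Fin (d + 1) → ℤ) : trK (InterLevelTransport.onLat N Q v) = -sgnK (InterLevelTransport.onLat N Q v) := by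
  unfold InterLevelTransport.onLat
  split_ifs
  · exact hpar _
  · funext x z a b
    simp [trK_apply, sgnK_apply]

/-- [folklore] The weighted superposition of the negated family. -/
theorem wsum_neg_family (w : (Fin (d + 1) → ℤ) → ℝ) (T : (Fin (d + 1) → ℤ) → MKer (d + 1) (Fib d)) :
    wsum w (fun u => -T u) = -wsum w T := by
  funext x z a b
  simp only [OneStepResolventKernel.wsum, Pi.neg_apply, mul_neg, tsum_neg]

/-- [folklore] A weighted superposition (scalar weights) of parity-odd kernels is parity-odd. -/
theorem parityOdd_wsum (w : (Fin (d + 1) → ℤ) → ℝ) {T : (Fin (d + 1) → ℤ) → MKer (d + 1) (Fib d)}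
    (hpar : ∀ u, trK (T u) = -sgnK (T u)) : trK (wsum w T) = -sgnK (wsum w T) := by
  rw [trK_wsum, sgnK_wsum, ← wsum_neg_family]
  congr 1
  funext u
  exact hpar u

/-- [folklore] A coarse-indexed superposition `cwsum` (scalar weights) of parity-odd kernels is parity-odd. -/
theorem parityOdd_cwsum (w : (Fin (d + 1) → ℤ) → ℝ) {Q : (Fin (d + 1) → ℤ) → MKer (d + 1) (Fib d)}
    (hpar : ∀ y, trK (Q y) = -sgnK (Q y)) : trK (cwsum N w Q) = -sgnK (cwsum N w Q) := by
  unfold InterLevelTransport.cwsum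
  exact parityOdd_wsum _ (parityOdd_onLat hpar)

/-- [folklore] `sgnK` is additive. -/
theorem sgnK_add (A B : MKer (d + 1) (Fib d)) : sgnK (A + B) = sgnK A + sgnK B := by
  funext x z a b
  simp only [sgnK_apply, Pi.add_apply]
  ring

/-- [folklore] **PARITY-ODDNESS IS CLOSED UNDER ADDITION**: remainders may be accumulated piece by piece. -/
theorem parityOdd_add {A B : MKer (d + 1) (Fib d)} (hA : trK A = -sgnK A) (hB : trK B = -sgnK B) :
    trK (A + B) = -sgnK (A + B) := by
  rw [trK_add, hA, hB, sgnK_add, neg_add]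

/-- [folklore] **A ROW-WISE PARITY-ODD TABLE HAS A PARITY-ODD CHAIN-RULE VERTEX** (any `K`, any `N`): if every row satisfies
`trK (S κ u) = −sgnK (S κ u)` then `trK (vertexOfK K N S μ y) = −sgnK (vertexOfK K N S μ y)` — the structural remainder socket `hNt`. -/
theorem trK_vertexOfK_eq_neg_sgnK_of_rows (K : MKer (d + 1) (Fib d)) {S : Fin (d + 1) → (Fin (d + 1) → ℤ) → MKer (d + 1) (Fib d)}
    (hpar : ∀ κ u, trK (S κ u) = -sgnK (S κ u)) (μ : Fin (d + 1)) (y : Fin (d + 1) → ℤ) :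
    trK (vertexOfK K N S μ y) = -sgnK (vertexOfK K N S μ y) := by
  rw [trK_vertexOfK, sgnK_vertexOfK, ← vertexOfK_neg]
  congr 1
  funext κ u
  exact hpar κ u

/-- [folklore] The `vertexOfM` twin: a row-wise parity-odd multiplier-slot table has a parity-odd `vertexOfM` (any `K`, any `N`). -/
theorem trK_vertexOfM_eq_neg_sgnK_of_rows (K : MKer (d + 1) (Fib d)) {M : Fin (d + 1) → (Fin (d + 1) → ℤ) → MKer (d + 1) (Fib d)}
    (hpar : ∀ ρ w, trK (M ρ w) = -sgnK (M ρ w)) (μ : Fin (d + 1)) (y : Fin (d + 1) → ℤ) :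
    trK (vertexOfM K N M μ y) = -sgnK (vertexOfM K N M μ y) := by
  have key : ∀ ρ, trK (cwsum N (colM K N μ y ρ) (M ρ)) = -sgnK (cwsum N (colM K N μ y ρ) (M ρ)) := fun ρ =>
    parityOdd_cwsum _ (hpar ρ)
  funext x z a b
  have k2 : ∀ ρ, cwsum N (colM K N μ y ρ) (M ρ) z x b a = -(sgnF a * sgnF b * cwsum N (colM K N μ y ρ) (M ρ) x z a b) := fun ρ => by
    have h := congrFun (congrFun (congrFun (congrFun (key ρ) x) z) a) b
    simpa only [trK_apply, Pi.neg_apply, sgnK_apply] using h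
  simp only [trK_apply, Pi.neg_apply, sgnK_apply, SecondOrderResponse.vertexOfM, k2, Finset.sum_neg_distrib]
  rw [Finset.mul_sum]

end Parity

/-! ## §2 The tadpole of the chain-rule vertex of a local row-parity-odd table vanishes against a sgn-symmetric propagator -/

section Tadpole

/-- [folklore] **TADPOLE-NULL REMAINDERS FROM ROW PARITY.**  For a spread sgn-SYMMETRIC propagator `K` (`trK K = sgnK K`) and a LOCAL table
family whose rows are parity-ODD, `tadpole K (vertexOfK K N S μ y) = 0`: the vertex is localised (`loc_vertexOfK`) and parity-odd (§1), and
`KernelWardRelativeEnd.tadpole_eq_zero_of_parity` closes. -/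
theorem tadpole_vertexOfK_eq_zero_of_rows {K : MKer (d + 1) (Fib d)} (hK : Spr K) (hKt : trK K = sgnK K)
    {S : Fin (d + 1) → (Fin (d + 1) → ℤ) → MKer (d + 1) (Fib d)} {Cs δ : ℝ} (hS : LocStencil S Cs δ) (hδ : 0 < δ)
    (hpar : ∀ κ u, trK (S κ u) = -sgnK (S κ u)) (μ : Fin (d + 1)) (y : Fin (d + 1) → ℤ) :
    tadpole K (vertexOfK K N S μ y) = 0 :=
  tadpole_eq_zero_of_parity hK hKt (loc_vertexOfK (N := N) hK hS hδ μ y) (trK_vertexOfK_eq_neg_sgnK_of_rows K hpar μ y)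

end Tadpole

/-! ## §3 The wall instance: the three END sockets for remainders `vertexOfK G_j Lc (R j y) ν y′`, every step, every in-block root -/

section Wall

variable {Lc : ℕ} [NeZero Lc] {r : Fin (d + 1) → ℕ}

/-- [folklore] **SOCKET `hNr`**: for the wall's step propagators `G_j` and any family of LOCAL remainder tables `R j y` (R-loc), the
remainder `Nr j y ν y′ := vertexOfK G_j Lc (R j y) ν y′` is localised — in the literal binder shape of the `hW` ends. -/
theorem remainder_loc (hr : r ∈ box (d + 1) Lc)
    {R : ℕ → (Fin (d + 1) → ℤ) → Fin (d + 1) → (Fin (d + 1) → ℤ) → MKer (d + 1) (Fib d)}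
    (hRl : ∀ j y, ∃ C δ : ℝ, 0 < δ ∧ LocStencil (R j y) C δ) :
    ∀ (j : ℕ) (y : Fin (d + 1) → ℤ) (ν : Fin (d + 1)) (y' : Fin (d + 1) → ℤ),
      Loc (vertexOfK (coDressKBmAt (toSite r) Lc (KInvStep (d := d) Lc j)) Lc (R j y) ν y') := fun j y ν y' => by
  obtain ⟨C, δ, hδ, hR⟩ := hRl j y
  exact loc_vertexOfK (spr_of_decays (decays_coDressKBmAt_KInvStep hr j)) hR hδ ν y'

/-- [folklore] **SOCKET `hNt`**: for any family of ROW-PARITY-ODD remainder tables (R-par), the remainder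
`vertexOfK G_j Lc (R j y) ν y′` is parity-odd — in the literal binder shape of the parity-form ends. -/
theorem remainder_parity {R : ℕ → (Fin (d + 1) → ℤ) → Fin (d + 1) → (Fin (d + 1) → ℤ) → MKer (d + 1) (Fib d)}
    (hRp : ∀ j y κ u, trK (R j y κ u) = -sgnK (R j y κ u)) :
    ∀ (j : ℕ) (y : Fin (d + 1) → ℤ) (ν : Fin (d + 1)) (y' : Fin (d + 1) → ℤ),
      trK (vertexOfK (coDressKBmAt (toSite r) Lc (KInvStep (d := d) Lc j)) Lc (R j y) ν y') =
        -sgnK (vertexOfK (coDressKBmAt (toSite r) Lc (KInvStep (d := d) Lc j)) Lc (R j y) ν y') :=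
  fun j y ν y' => trK_vertexOfK_eq_neg_sgnK_of_rows _ (hRp j y) ν y'

/-- [folklore] **SOCKET `hN0`: THE `G_j`-TADPOLE OF THE REMAINDER VANISHES**, every step `j`, every in-block root, for any family of local
(R-loc) row-parity-odd (R-par) remainder tables: `tadpole G_j (vertexOfK G_j Lc (R j y) ν y′) = 0` — in the literal binder shape of the
scalar-form ends (`G_j` is spread by `decays_coDressKBmAt_KInvStep` and sgn-symmetric by `BubbleParity.trK_coDressKBmAt_KInvStep`). -/
theorem remainder_tadpole_eq_zero (hr : r ∈ box (d + 1) Lc)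
    {R : ℕ → (Fin (d + 1) → ℤ) → Fin (d + 1) → (Fin (d + 1) → ℤ) → MKer (d + 1) (Fib d)}
    (hRl : ∀ j y, ∃ C δ : ℝ, 0 < δ ∧ LocStencil (R j y) C δ) (hRp : ∀ j y κ u, trK (R j y κ u) = -sgnK (R j y κ u)) :
    ∀ (j : ℕ) (y : Fin (d + 1) → ℤ) (ν : Fin (d + 1)) (y' : Fin (d + 1) → ℤ),
      tadpole (coDressKBmAt (toSite r) Lc (KInvStep (d := d) Lc j))
        (vertexOfK (coDressKBmAt (toSite r) Lc (KInvStep (d := d) Lc j)) Lc (R j y) ν y') = 0 := fun j y ν y' => by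
  obtain ⟨C, δ, hδ, hR⟩ := hRl j y
  exact tadpole_vertexOfK_eq_zero_of_rows (spr_of_decays (decays_coDressKBmAt_KInvStep hr j)) (trK_coDressKBmAt_KInvStep hr j)
    hR hδ (hRp j y) ν y'

/-- [folklore] **ACCUMULATED REMAINDERS**: a remainder assembled from the chain-rule vertex of a local row-parity-odd table PLUS any further
localised parity-odd piece `P j y ν y′` (e.g. from the mixed or response summands of the second-order carrier) still meets both scalar
sockets: it is localised and its `G_j`-tadpole vanishes. -/
theorem remainder_add_tadpole_eq_zero (hr : r ∈ box (d + 1) Lc)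
    {R : ℕ → (Fin (d + 1) → ℤ) → Fin (d + 1) → (Fin (d + 1) → ℤ) → MKer (d + 1) (Fib d)}
    (hRl : ∀ j y, ∃ C δ : ℝ, 0 < δ ∧ LocStencil (R j y) C δ) (hRp : ∀ j y κ u, trK (R j y κ u) = -sgnK (R j y κ u))
    {P : ℕ → (Fin (d + 1) → ℤ) → Fin (d + 1) → (Fin (d + 1) → ℤ) → MKer (d + 1) (Fib d)}
    (hPl : ∀ j y ν y', Loc (P j y ν y')) (hPp : ∀ j y ν y', trK (P j y ν y') = -sgnK (P j y ν y')) :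
    ∀ (j : ℕ) (y : Fin (d + 1) → ℤ) (ν : Fin (d + 1)) (y' : Fin (d + 1) → ℤ),
      Loc (vertexOfK (coDressKBmAt (toSite r) Lc (KInvStep (d := d) Lc j)) Lc (R j y) ν y' + P j y ν y') ∧
      tadpole (coDressKBmAt (toSite r) Lc (KInvStep (d := d) Lc j))
        (vertexOfK (coDressKBmAt (toSite r) Lc (KInvStep (d := d) Lc j)) Lc (R j y) ν y' + P j y ν y') = 0 := fun j y ν y' => by
  have hL := remainder_loc hr hRl j y ν y'
  refine ⟨hL.add (hPl j y ν y'), ?_⟩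
  exact tadpole_eq_zero_of_parity (spr_of_decays (decays_coDressKBmAt_KInvStep hr j)) (trK_coDressKBmAt_KInvStep hr j)
    (hL.add (hPl j y ν y')) (parityOdd_add (remainder_parity hRp j y ν y') (hPp j y ν y'))

end Wall

end Summit.QuantumFields.BalabanUV.Beta.KernelWardRemainderParity

end
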